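import Mathlib
import Literature.AlgebraicGeometry.Resolution.CobordantChartCoefficients

/-!
# `WeightedInvariant.LocalWeightedDrop`, line `cone-game-restriction-rank`: point blow-up is order-safe

Route `ResolutionOfSingularities/WeightedInvariant`, crux `LocalWeightedDrop`
(stmt-ResolutionOfSingularities-8899), stub `stub_pointBlowupOrder` of the lead's skeleton
`work/LocalWeightedDrop.lean`, PROVED here (statement verbatim from the ledger registration).

**Statement (POINT BLOW-UP IS ORDER-SAFE).** Let `F ≠ 0` be a formal power series in
`x₁, …, xₙ` over a field `k` and `c : Fin n → k` any point.  The cobordant chart with all weights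
`1`, `chart 1 c : xᵢ ↦ s (cᵢ + yᵢ)` (`s = X 0`, `yᵢ = X i.succ`), is the blow-up of the origin seen
at the exceptional point `c`.  Factor `F(s(c+y)) = sᵃ · g` with `s ∤ g`, and let
`g(0,·) := (β ↦ coeff (Finsupp.cons 0 β) g)` be the `n`-variable slice of `g` along the
exceptional divisor `s = 0` (a multivariate power series IS its coefficient function, so
`coeff β g(0,·) = coeff (cons 0 β) g` definitionally).  Then `ord g(0,·) ≤ ord F`.

**Proof.** All weights are positive, so the chart convention `cᵢ = 0` whenever `wᵢ = 0` holds
vacuously, and `CobordantChart.eq_weightedOrder_of_factor` gives `a = ord F` (Mathlib's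
`MvPowerSeries.order` is by definition the weighted order for the weights `fun _ => 1`, and the
degree of an exponent is its weight for these weights).  Pick an exponent `β` with `coeff β F ≠ 0`
and `|β| = ord F = a` (`MvPowerSeries.exists_coeff_ne_zero_and_weightedOrder`).  By
`CobordantChart.coeff_cons_of_eq_X_pow_mul`, `coeff β g(0,·) = coeff (cons a β) F(s(c+y))`, which
the COEFFICIENT FORMULA `CobordantChart.coeff_subst_chart` writes as
`∑_{d : |d| = a} F_d ∏ᵢ C(dᵢ, βᵢ) cᵢ^{dᵢ-βᵢ}`.  For `d ≠ β` with `|d| = a = |β|` some `i` has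
`dᵢ < βᵢ` (if `βᵢ ≤ dᵢ` for all `i`, equality of the sums `∑ βᵢ = ∑ dᵢ` forces `β = d`,
`Finset.sum_eq_sum_iff_of_le`), so `C(dᵢ, βᵢ) = 0` kills that summand; the finitely supported sum
collapses (`finsum_eq_single`) to the term `d = β`, which is `F_β ∏ᵢ C(βᵢ, βᵢ) cᵢ⁰ = F_β ≠ 0`
(the top-degree part of a translated form is the form itself).  Hence
`ord g(0,·) ≤ |β| = ord F` (`MvPowerSeries.weightedOrder_le`).
-/

set_option linter.dupNamespace false -- mandated namespace of this single-conjunct summit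

namespace Summit.ResolutionOfSingularities.ResolutionOfSingularities.Theorems

open Literature.AlgebraicGeometry.Resolution

/-- The weight of an exponent vector for the constant weights `1` is the sum of its entries:
`weight 1 d = ∑ i, d i`. -/
private theorem weight_one_eq_sum_apply {n : ℕ} (d : Fin n →₀ ℕ) :
    Finsupp.weight (fun _ : Fin n => 1) d = ∑ i, d i := by
  rw [Finsupp.weight_apply, Finsupp.sum_fintype _ _ (fun _ => by simp)]
  simp

/-- POINT BLOW-UP IS ORDER-SAFE, stub `stub_pointBlowupOrder` of the line
`cone-game-restriction-rank` of crux `LocalWeightedDrop` (stmt-ResolutionOfSingularities-8899).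
Under the homothety `w = (1,…,1)` (the cobordant form of the blow-up of the origin), at every
exceptional point `c` the `s⁰`-slice `g(0,·) = (β ↦ coeff (cons 0 β) g)` of the `s`-saturated
transform `g` of `F ≠ 0` (`F(s(c+y)) = sᵃ·g`, `s ∤ g`) has order at most `ord F`: its degree-`ord F`
part is the degree-`ord F` form of `F` itself. -/
theorem stub_pointBlowupOrder : ∀ (k : Type) [Field k] (n : ℕ) (F : MvPowerSeries (Fin n) k), F ≠ 0 →
    ∀ (c : Fin n → k) (a : ℕ) (g : MvPowerSeries (Fin (n + 1)) k),
    MvPowerSeries.subst (CobordantChart.chart (fun _ : Fin n => 1) c) F = MvPowerSeries.X 0 ^ a * g →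
    ¬ (MvPowerSeries.X (0 : Fin (n + 1)) ∣ g) →
    MvPowerSeries.order
      (show MvPowerSeries (Fin n) k from fun β => MvPowerSeries.coeff (Finsupp.cons 0 β) g) ≤ F.order := by
  intro k _ n F hF c a g hfac hndvd
  -- all weights are `1 ≠ 0`: the chart convention holds vacuously
  have hc : ∀ i, (fun _ : Fin n => 1) i = 0 → c i = 0 := fun i hi => absurd hi one_ne_zero
  -- `a = ord F` (the order is the weighted order for the weights `1`)
  have ha : (a : ℕ∞) = F.weightedOrder (fun _ : Fin n => 1) :=
    CobordantChart.eq_weightedOrder_of_factor _ c hc hF hfac hndvd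
  -- a top-degree exponent `β` of `F`: `coeff β F ≠ 0`, `|β| = ord F = a`
  obtain ⟨β, hβF, hβw⟩ := MvPowerSeries.exists_coeff_ne_zero_and_weightedOrder (fun _ : Fin n => 1)
    ((MvPowerSeries.ne_zero_iff_weightedOrder_finite (fun _ : Fin n => 1)).mp hF)
  have hβa : Finsupp.weight (fun _ : Fin n => 1) β = a := by
    have h : ((Finsupp.weight (fun _ : Fin n => 1) β : ℕ) : ℕ∞) = (a : ℕ∞) := by rw [hβw, ha]
    exact_mod_cast h
  -- it suffices that the slice coefficient at `β` is non-zero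
  change MvPowerSeries.weightedOrder (fun _ : Fin n => 1)
      (show MvPowerSeries (Fin n) k from fun β => MvPowerSeries.coeff (Finsupp.cons 0 β) g) ≤
    F.weightedOrder (fun _ : Fin n => 1)
  rw [← hβw]
  refine MvPowerSeries.weightedOrder_le (fun _ : Fin n => 1) ?_
  change MvPowerSeries.coeff (Finsupp.cons 0 β) g ≠ 0
  -- the slice coefficient at `β` is the coefficient formula at `s^a y^β`, which collapses to `F_β`
  rw [CobordantChart.coeff_cons_of_eq_X_pow_mul hfac, add_zero,
    CobordantChart.coeff_subst_chart _ c hc, finsum_eq_single _ β]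
  · rw [if_pos hβa]
    simpa using hβF
  · intro d hdβ
    split_ifs with hwd
    · -- `|d| = a = |β|` and `d ≠ β`: some `i` has `d i < β i`, so `C(d i, β i) = 0`
      suffices h : ∃ i, d i < β i by
        obtain ⟨i, hi⟩ := h
        rw [Finset.prod_eq_zero (Finset.mem_univ i)
          (by rw [Nat.choose_eq_zero_of_lt hi, Nat.cast_zero, zero_mul]), mul_zero]
      by_contra hall
      push Not at hall
      apply hdβ
      have hsum : ∑ i, β i = ∑ i, d i := by
        rw [← weight_one_eq_sum_apply, ← weight_one_eq_sum_apply, hwd, hβa]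
      ext i
      exact ((Finset.sum_eq_sum_iff_of_le fun i _ => hall i).mp hsum i (Finset.mem_univ i)).symm
    · rfl

end Summit.ResolutionOfSingularities.ResolutionOfSingularities.Theorems
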